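import Literature.NumberTheory.ComplexMultiplication.EllipticUnits.ImaginaryQuadraticMainConjectureCarriersLift
import HarnessLib

/-!
# The pinned carriers `H^i(𝒪_K[1/p𝔣], Λ(χ)(1))` of Johnson-Leung–Kings 2011: SUB-DATA cut out by a
# conjugation-stable family of level subgroups, and `Λ`-LINEAR MAPS INTO THE QUOTIENT from level laws
# holding modulo the family — proved, no named fact

Topic `Literature/NumberTheory/ComplexMultiplication/EllipticUnits` (grouping sub-namespace
`JohnsonLeungKings2011`); sequel of `ImaginaryQuadraticMainConjectureCarriersLift.lean` (the universal
property of ty2 g37's `IwasawaCohomologyData`: `proj_smul`, `exists_linearMap_of_levelMaps`). Cell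
`bsd-print-cf2` (`run/shared/lean/pub/bsd-print-cf2/`), width seat `bsd-line-cf2c-w8` g8 (prover).
THEOREMS ONLY; no definition, no named fact, no `instance`, no `sorry`.

WHY. ROW 2 of the (α3) kernel descent (units side; seat `bsd-line-cf2-p1-w6` g8,
`Theorems/PrintCf2RubinValueTwoRowTwoUnitsLift.lean`) produces a map `G : E.Q → H¹` from Rubin's pinned
`(ℰ_∞/𝒞_∞)^θ` whose level components are Kummer classes of global units, well defined and additive and
`T_i`-compatible only MODULO the subgroups `C n k` spanned by the classes of the elliptic units (JLK §5.4:
"`𝒞_∞ = ⟨ℐ𝒥ζ(𝔤)⟩` up to torsion"); what the descent lemma consumes is the induced `Λ₂`-LINEAR map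
`E.Q →ₗ H¹ ⧸ C̃`, `C̃ = {h ∣ ∀ n k, proj n k h ∈ C n k}` (its successor list (ρ2)). This file supplies the
generic algebra:

* §5 `IsLocNil₂.smul_mem_of_stable`: a subgroup of a layer stable under the two operators is stable under
  the whole `ℤ_p⟦T₁,T₂⟧`-action (no uniformity needed); `layer_smul_mem_of_conj_stable` for the layer
  groups `H^i(G_S(K̃_n), μ_{p^k} ⊗ θ)`, `i ≤ 2`.
* §6 `IwasawaCohomologyData.exists_submodule_forall_proj_mem`: a `conj_{γ₁}, conj_{γ₂}`-stable family
  `C n k` cuts out a `Λ₂`-SUBMODULE `C̃` of the pinned carrier (`proj_smul`);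
  **`exists_linearMap_mkQ_of_levelLaws`**: ANY map `G : X → H` from a `Λ₂`-module that is additive and
  commutes with `T₁`, `T₂` and the constants LEVELWISE MODULO `C n k` induces a `Λ₂`-linear
  `X →ₗ[Λ₂] H ⧸ C̃`, `x ↦ [G x]` (subsemiring of good coefficients + uniform nilpotence `k·p^{n+k}` + the
  tree's double truncation `IwasawaDual.exists_eq_poly_add_X_pow_mul_add`).

HONEST FRAMING: module-theoretic bookkeeping; no arithmetic, no case of the main conjecture or of BSD is
proved here; no summit statement is proved by this seat.

## References
* [JohnsonLeungKings2011] J. Johnson-Leung, G. Kings, J. reine angew. Math. 653 (2011) = arXiv:0804.2828,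
  §4.2 Def. 4.2 (94) (p0012:L80–112), §5.4 with Lemma 5.8 (p0015:L150–165).
* [Lang1990] S. Lang, *Cyclotomic Fields I and II*, GTM 121, Ch. 5 §1 (Thm. 1.1).
* [GreenbergLNM1716] R. Greenberg, *Iwasawa theory for elliptic curves*, LNM 1716 (1999), §1.
* [Rubin1991] K. Rubin, Invent. Math. 103 (1991), §4 p. 36 (`ℰ_∞/𝒞_∞` as a `Λ`-module).
-/

noncomputable section

open scoped NumberField
open Field IsDedekindDomain PowerSeries
open Literature.NumberTheory.GaloisRepresentations
open Literature.NumberTheory.EllipticCurves Literature.NumberTheory.EllipticCurves.IwasawaDual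

/-! ## §5 A `conj_{γ₁}, conj_{γ₂}`-stable subgroup of a layer is stable under the whole `Λ₂`-action -/

namespace Literature.NumberTheory.EllipticCurves.IwasawaDual.IsLocNil₂

variable {S' : Type*} [AddCommGroup S'] {p : ℕ} [Fact p.Prime] {ψ₁' ψ₂' : AddMonoid.End S'}
  (h' : IsLocNil₂ p ψ₁' ψ₂')
include h'

/-- **A subgroup stable under `ψ₁`, `ψ₂` is stable under the whole `ℤ_p⟦T₁,T₂⟧`-action** of
`IsLocNil₂.selfModule`: `F • s` is a finite `ℤ`-combination of the `ψ₂^j ψ₁^i s` (double truncation of `F`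
at the nilpotency and torsion exponents of `s`; the remainders `T₁^N·A`, `T₂^N·B` act on `s` as
`A • ψ₁^N s = 0`, `B • ψ₂^N s = 0`). [cite: GreenbergLNM1716, §1 (after Conj. 1.3)] [cite: Lang1990, Ch. 5 §1 (Thm. 1.1)] -/
theorem smul_mem_of_stable (V : AddSubgroup S') (hV₁ : ∀ s ∈ V, ψ₁' s ∈ V) (hV₂ : ∀ s ∈ V, ψ₂' s ∈ V)
    (F : PowerSeries (PowerSeries ℤ_[p])) {s : S'} (hs : s ∈ V) : (letI := h'.selfModule; F • s) ∈ V := by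
  letI := h'.selfModule
  obtain ⟨N, _k, hs₁, hs₂, -⟩ := h'.exists_trunc s
  have hXpow : ∀ (m : ℕ) {t : S'}, t ∈ V → (X : PowerSeries (PowerSeries ℤ_[p])) ^ m • t ∈ V := by
    intro m t ht
    induction m with
    | zero => rwa [pow_zero, one_smul]
    | succ m ih => rw [pow_succ', mul_smul, h'.X_smul]; exact hV₁ _ ih
  have hCXpow : ∀ (m : ℕ) {t : S'}, t ∈ V → (C X : PowerSeries (PowerSeries ℤ_[p])) ^ m • t ∈ V := by
    intro m t ht
    induction m with
    | zero => rwa [pow_zero, one_smul]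
    | succ m ih => rw [pow_succ', mul_smul, h'.C_X_smul]; exact hV₂ _ ih
  have hCC : ∀ (c : ℤ_[p]) {t : S'}, t ∈ V → (C (C c) : PowerSeries (PowerSeries ℤ_[p])) • t ∈ V := by
    intro c t ht
    obtain ⟨k', hk'⟩ := h'.torsion t
    rw [h'.C_C_smul c hk']
    exact V.nsmul_mem ht _
  obtain ⟨A, B, hF⟩ := exists_eq_poly_add_X_pow_mul_add F N
  have hrem₁ : ((X : PowerSeries (PowerSeries ℤ_[p])) ^ N * A) • s = 0 := by
    rw [mul_comm, mul_smul, h'.X_pow_smul, hs₁, smul_zero]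
  have hrem₂ : ((C X : PowerSeries (PowerSeries ℤ_[p])) ^ N * B) • s = 0 := by
    rw [mul_comm, mul_smul, h'.C_X_pow_smul, hs₂, smul_zero]
  rw [hF, add_smul, add_smul, hrem₁, hrem₂, add_zero, add_zero, Finset.sum_smul]
  refine V.sum_mem fun i _ ↦ ?_
  rw [Finset.sum_smul]
  refine V.sum_mem fun j _ ↦ ?_
  rw [mul_smul, mul_smul]
  exact hCC _ (hCXpow _ (hXpow _ hs))

end Literature.NumberTheory.EllipticCurves.IwasawaDual.IsLocNil₂

namespace Literature.NumberTheory.ComplexMultiplication.EllipticUnits.JohnsonLeungKings2011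

section LayerStable

variable {K : Type} [Field K] [NumberField K] (p : ℕ) [Fact p.Prime]
  (κ₁ κ₂ : ZpExtension K p) (γ₁ γ₂ : absoluteGaloisGroup K)
  (θ : absoluteGaloisGroup K →ₜ* ℤ_[p]ˣ) (𝔣 : Ideal (𝓞 K))

/-- **A subgroup of a layer group stable under `conj_{γ₁}` and `conj_{γ₂}` is stable under the whole
`Λ₂`-action** `T_i ↦ conj_{γ_i} − 1` (`IsLocNil₂.smul_mem_of_stable`), `i ≤ 2`.
[cite: JohnsonLeungKings2011, §4.2 (arXiv p0012:L109–112)] [cite: Lang1990, Ch. 5 §1 (Thm. 1.1)] -/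
theorem layer_smul_mem_of_conj_stable (n k : ℕ) {i : ℕ} (hi : i ≤ 2)
    (C : AddSubgroup (layerCoh p κ₁ κ₂ θ 𝔣 n k i))
    (hC₁ : ∀ c ∈ C, layerConj p κ₁ κ₂ θ 𝔣 n k i γ₁ c ∈ C) (hC₂ : ∀ c ∈ C, layerConj p κ₁ κ₂ θ 𝔣 n k i γ₂ c ∈ C)
    (F : IwasawaAlgebra₂ p) {c : layerCoh p κ₁ κ₂ θ 𝔣 n k i} (hc : c ∈ C) :
    (letI := (isLocNil₂_layerConjEnd p κ₁ κ₂ γ₁ γ₂ θ 𝔣 n k hi).selfModule; F • c) ∈ C :=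
  (isLocNil₂_layerConjEnd p κ₁ κ₂ γ₁ γ₂ θ 𝔣 n k hi).smul_mem_of_stable C
    (fun c hc ↦ by rw [layerConjEnd_sub_one_apply]; exact C.sub_mem (hC₁ c hc) hc)
    (fun c hc ↦ by rw [layerConjEnd_sub_one_apply]; exact C.sub_mem (hC₂ c hc) hc) F hc

end LayerStable

namespace IwasawaCohomologyData

variable {K : Type} [Field K] [NumberField K] {p : ℕ} [Fact p.Prime]
  {κ₁ κ₂ : ZpExtension K p} {γ₁ γ₂ : absoluteGaloisGroup K}
  {θ : absoluteGaloisGroup K →ₜ* ℤ_[p]ˣ} {𝔣 : Ideal (𝓞 K)} {i : ℕ}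
  (I : IwasawaCohomologyData p κ₁ κ₂ γ₁ γ₂ θ 𝔣 i)

/-! ## §6 Sub-data: a conjugation-stable family of level subgroups cuts out a `Λ₂`-submodule, and
level laws MODULO the family give `Λ₂`-linear maps into the quotient (the form ROW 2 consumes:
units modulo the images of the elliptic units) -/

section Quotient

variable {X : Type*} [AddCommGroup X] [Module (IwasawaAlgebra₂ p) X]

/-- **A family of level subgroups `C n k ≤ H^i(G_S(K̃_n), μ_{p^k} ⊗ θ)` stable under `conj_{γ₁}`, `conj_{γ₂}`
cuts out a `Λ₂`-SUBMODULE `C̃ = {h ∣ ∀ n k, proj n k h ∈ C n k}` of the pinned carrier** (`i ≤ 2`): by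
`proj_smul` and the stability of each `C n k` under the whole layer action (`layer_smul_mem_of_conj_stable`).
E.g. `C n k` = the span of the corestricted twisted Kummer classes of the elliptic units of the layer
(JLK §5.4, "`𝒞_∞ = ⟨ℐ𝒥ζ(𝔤)⟩` up to torsion"). [cite: JohnsonLeungKings2011, §4.2 and §5.4 (arXiv p0012:L109–112, p0015:L150–165)] [cite: Lang1990, Ch. 5 §1 (Thm. 1.1)] -/
theorem exists_submodule_forall_proj_mem (hi : i ≤ 2) (C : ∀ n k : ℕ, AddSubgroup (layerCoh p κ₁ κ₂ θ 𝔣 n k i))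
    (hC₁ : ∀ (n k : ℕ) (c : layerCoh p κ₁ κ₂ θ 𝔣 n k i), c ∈ C n k → layerConj p κ₁ κ₂ θ 𝔣 n k i γ₁ c ∈ C n k)
    (hC₂ : ∀ (n k : ℕ) (c : layerCoh p κ₁ κ₂ θ 𝔣 n k i), c ∈ C n k → layerConj p κ₁ κ₂ θ 𝔣 n k i γ₂ c ∈ C n k) :
    ∃ Ct : Submodule (IwasawaAlgebra₂ p) I.H, ∀ h : I.H, h ∈ Ct ↔ ∀ n k : ℕ, I.proj n k h ∈ C n k :=
  ⟨{ carrier := {h | ∀ n k : ℕ, I.proj n k h ∈ C n k}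
     zero_mem' := fun n k ↦ by rw [map_zero]; exact zero_mem _
     add_mem' := fun {a b} ha hb n k ↦ by rw [map_add]; exact add_mem (ha n k) (hb n k)
     smul_mem' := fun F h hh n k ↦ by
       rw [I.proj_smul hi]
       exact layer_smul_mem_of_conj_stable p κ₁ κ₂ γ₁ γ₂ θ 𝔣 n k hi (C n k) (hC₁ n k) (hC₂ n k) F (hh n k) },
    fun _ ↦ Iff.rfl⟩

/-- **Λ₂-LINEAR MAPS INTO THE QUOTIENT `H ⧸ C̃` FROM LEVEL LAWS MODULO THE FAMILY** (`i ≤ 2`). Let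
`C n k` be a `conj_{γ₁}, conj_{γ₂}`-stable family of level subgroups with submodule `C̃` (as in
`exists_submodule_forall_proj_mem`), and `G : X → H` ANY map from a `Λ₂`-module `X` that is additive and
commutes with `T₁ = X`, `T₂ = C X` and the constants `C (C c)` LEVELWISE MODULO `C n k`
(`proj n k (G (x + y) − G x − G y) ∈ C n k`, `proj n k (G (T • x) − T • G x) ∈ C n k`). Then `x ↦ [G x]`
is a `Λ₂`-linear map `X →ₗ[Λ₂] H ⧸ C̃`. (For `F ∈ Λ₂`: the `F` with `proj n k (G (F • x) − F • G x) ∈ C n k`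
for all `x` form a subsemiring containing the three kinds of generators and `T_j^N·A` for the uniform
nilpotency exponent `N = k·p^{n+k}` of §1; conclude by the double truncation
`IwasawaDual.exists_eq_poly_add_X_pow_mul_add`.) This is the shape of the units-side ROW 2: Rubin's
`(ℰ_∞/𝒞_∞)^θ` → `H¹ ⧸ C̃` from levelwise Kummer maps defined up to the elliptic units.
[cite: JohnsonLeungKings2011, §5.4 Lemma 5.8 and Def. 4.2 (94) (arXiv p0015:L150–165, p0012:L94)] [cite: Lang1990, Ch. 5 §1 (Thm. 1.1)] -/
theorem exists_linearMap_mkQ_of_levelLaws (hi : i ≤ 2) (C : ∀ n k : ℕ, AddSubgroup (layerCoh p κ₁ κ₂ θ 𝔣 n k i))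
    (hC₁ : ∀ (n k : ℕ) (c : layerCoh p κ₁ κ₂ θ 𝔣 n k i), c ∈ C n k → layerConj p κ₁ κ₂ θ 𝔣 n k i γ₁ c ∈ C n k)
    (hC₂ : ∀ (n k : ℕ) (c : layerCoh p κ₁ κ₂ θ 𝔣 n k i), c ∈ C n k → layerConj p κ₁ κ₂ θ 𝔣 n k i γ₂ c ∈ C n k)
    (Ct : Submodule (IwasawaAlgebra₂ p) I.H) (hCt : ∀ h : I.H, h ∈ Ct ↔ ∀ n k : ℕ, I.proj n k h ∈ C n k)
    (G : X → I.H) (hadd : ∀ (x y : X) (n k : ℕ), I.proj n k (G (x + y) - G x - G y) ∈ C n k)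
    (h₁ : ∀ (n k : ℕ) (x : X),
      I.proj n k (G ((PowerSeries.X : IwasawaAlgebra₂ p) • x) - (PowerSeries.X : IwasawaAlgebra₂ p) • G x) ∈ C n k)
    (h₂ : ∀ (n k : ℕ) (x : X),
      I.proj n k (G ((PowerSeries.C (PowerSeries.X : IwasawaAlgebra p) : IwasawaAlgebra₂ p) • x) -
        (PowerSeries.C (PowerSeries.X : IwasawaAlgebra p) : IwasawaAlgebra₂ p) • G x) ∈ C n k)
    (h₃ : ∀ (c : ℤ_[p]) (n k : ℕ) (x : X),
      I.proj n k (G ((PowerSeries.C (PowerSeries.C c : IwasawaAlgebra p) : IwasawaAlgebra₂ p) • x) -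
        (PowerSeries.C (PowerSeries.C c : IwasawaAlgebra p) : IwasawaAlgebra₂ p) • G x) ∈ C n k) :
    ∃ Φ : X →ₗ[IwasawaAlgebra₂ p] I.H ⧸ Ct, ∀ x : X, Φ x = Ct.mkQ (G x) := by
  -- `G 0 ≡ 0`, hence `G` is additive modulo `C̃`
  have h0 : ∀ n k, I.proj n k (G 0) ∈ C n k := fun n k ↦ by
    have h := hadd 0 0 n k
    rw [add_zero, sub_self, zero_sub, map_neg] at h
    exact neg_mem_iff.mp h
  have hGadd : ∀ x y : X, G (x + y) - G x - G y ∈ Ct := fun x y ↦ (hCt _).2 fun n k ↦ hadd x y n k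
  -- linearity modulo `C̃`, level by level: the good coefficients form a subsemiring
  have hsmul : ∀ (F : IwasawaAlgebra₂ p) (x : X), G (F • x) - F • G x ∈ Ct := by
    intro F x
    refine (hCt _).2 fun n k ↦ ?_
    let R : Subsemiring (IwasawaAlgebra₂ p) :=
      { carrier := {F | ∀ x : X, I.proj n k (G (F • x) - F • G x) ∈ C n k}
        mul_mem' := fun {a b} ha hb x ↦ by
          have hsplit : G ((a * b) • x) - (a * b) • G x =
              (G (a • b • x) - a • G (b • x)) + a • (G (b • x) - b • G x) := by
            rw [mul_smul, mul_smul, smul_sub]; abel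
          rw [hsplit, map_add, I.proj_smul hi n k a]
          exact add_mem (ha (b • x))
            (layer_smul_mem_of_conj_stable p κ₁ κ₂ γ₁ γ₂ θ 𝔣 n k hi (C n k) (hC₁ n k) (hC₂ n k) a (hb x))
        one_mem' := fun x ↦ by
          rw [one_smul, one_smul, sub_self, map_zero]; exact zero_mem _
        add_mem' := fun {a b} ha hb x ↦ by
          have hsplit : G ((a + b) • x) - (a + b) • G x =
              (G (a • x + b • x) - G (a • x) - G (b • x)) + (G (a • x) - a • G x) + (G (b • x) - b • G x) := by
            rw [add_smul, add_smul]; abel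
          rw [hsplit, map_add, map_add]
          exact add_mem (add_mem (hadd _ _ n k) (ha x)) (hb x)
        zero_mem' := fun x ↦ by
          rw [zero_smul, zero_smul, sub_zero]; exact h0 n k }
    have hR : ∀ F : IwasawaAlgebra₂ p, F ∈ R ↔ ∀ x : X, I.proj n k (G (F • x) - F • G x) ∈ C n k :=
      fun F ↦ Iff.rfl
    have hX : (PowerSeries.X : IwasawaAlgebra₂ p) ∈ R := (hR _).2 (h₁ n k)
    have hCX : (PowerSeries.C (PowerSeries.X : IwasawaAlgebra p) : IwasawaAlgebra₂ p) ∈ R := (hR _).2 (h₂ n k)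
    have hCC : ∀ c : ℤ_[p], (PowerSeries.C (PowerSeries.C c : IwasawaAlgebra p) : IwasawaAlgebra₂ p) ∈ R :=
      fun c ↦ (hR _).2 (h₃ c n k)
    -- the remainders `T_j^N · A`: `T_j^N ∈ R` and `T_j^N` kills the layer
    have hN := isLocNil₂_layerConjEnd p κ₁ κ₂ γ₁ γ₂ θ 𝔣 n k hi
    have hXN : ∀ A : IwasawaAlgebra₂ p, (PowerSeries.X : IwasawaAlgebra₂ p) ^ (k * p ^ (n + k)) * A ∈ R := by
      intro A
      refine (hR _).2 fun x ↦ ?_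
      have hsplit : G (((PowerSeries.X : IwasawaAlgebra₂ p) ^ (k * p ^ (n + k)) * A) • x) -
            ((PowerSeries.X : IwasawaAlgebra₂ p) ^ (k * p ^ (n + k)) * A) • G x =
          (G ((PowerSeries.X : IwasawaAlgebra₂ p) ^ (k * p ^ (n + k)) • A • x) -
              (PowerSeries.X : IwasawaAlgebra₂ p) ^ (k * p ^ (n + k)) • G (A • x)) +
            (PowerSeries.X : IwasawaAlgebra₂ p) ^ (k * p ^ (n + k)) • (G (A • x) - A • G x) := by
        rw [mul_smul, mul_smul, smul_sub]; abel
      rw [hsplit, map_add, I.proj_smul hi n k (_ ^ _), hN.X_pow_smul,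
        layerConjEnd_sub_one_pow_apply_eq_zero p κ₁ κ₂ θ 𝔣 n k hi γ₁, add_zero]
      exact (hR _).1 (R.pow_mem hX _) (A • x)
    have hCXN : ∀ B : IwasawaAlgebra₂ p,
        (PowerSeries.C (PowerSeries.X : IwasawaAlgebra p) : IwasawaAlgebra₂ p) ^ (k * p ^ (n + k)) * B ∈ R := by
      intro B
      refine (hR _).2 fun x ↦ ?_
      have hsplit : G (((PowerSeries.C (PowerSeries.X : IwasawaAlgebra p) : IwasawaAlgebra₂ p) ^
              (k * p ^ (n + k)) * B) • x) -
            ((PowerSeries.C (PowerSeries.X : IwasawaAlgebra p) : IwasawaAlgebra₂ p) ^ (k * p ^ (n + k)) * B) • G x =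
          (G ((PowerSeries.C (PowerSeries.X : IwasawaAlgebra p) : IwasawaAlgebra₂ p) ^ (k * p ^ (n + k)) • B • x) -
              (PowerSeries.C (PowerSeries.X : IwasawaAlgebra p) : IwasawaAlgebra₂ p) ^ (k * p ^ (n + k)) •
                G (B • x)) +
            (PowerSeries.C (PowerSeries.X : IwasawaAlgebra p) : IwasawaAlgebra₂ p) ^ (k * p ^ (n + k)) •
              (G (B • x) - B • G x) := by
        rw [mul_smul, mul_smul, smul_sub]; abel
      rw [hsplit, map_add, I.proj_smul hi n k (_ ^ _), hN.C_X_pow_smul,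
        layerConjEnd_sub_one_pow_apply_eq_zero p κ₁ κ₂ θ 𝔣 n k hi γ₂, add_zero]
      exact (hR _).1 (R.pow_mem hCX _) (B • x)
    -- double truncation
    obtain ⟨A, B, hF⟩ := exists_eq_poly_add_X_pow_mul_add F (k * p ^ (n + k))
    have hpoly : (∑ i ∈ Finset.range (k * p ^ (n + k)), ∑ j ∈ Finset.range (k * p ^ (n + k)),
        PowerSeries.C (PowerSeries.C (PowerSeries.coeff j (PowerSeries.coeff i F))) *
          (PowerSeries.C PowerSeries.X) ^ j * PowerSeries.X ^ i : IwasawaAlgebra₂ p) ∈ R :=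
      R.sum_mem fun i _ ↦ R.sum_mem fun j _ ↦
        R.mul_mem (R.mul_mem (hCC _) (R.pow_mem hCX _)) (R.pow_mem hX _)
    have hFR : F ∈ R := by
      rw [hF]
      exact R.add_mem (R.add_mem hpoly (hXN A)) (hCXN B)
    exact (hR F).1 hFR x
  refine ⟨{ toFun := fun x ↦ Ct.mkQ (G x)
            map_add' := fun x y ↦ ?_
            map_smul' := fun F x ↦ ?_ }, fun x ↦ rfl⟩
  · rw [← map_add, ← sub_eq_zero, ← map_sub, Submodule.mkQ_apply, Submodule.Quotient.mk_eq_zero, ← sub_sub]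
    exact hGadd x y
  · rw [RingHom.id_apply, ← map_smul, ← sub_eq_zero, ← map_sub, Submodule.mkQ_apply,
      Submodule.Quotient.mk_eq_zero]
    exact hsmul F x

end Quotient

end IwasawaCohomologyData

end Literature.NumberTheory.ComplexMultiplication.EllipticUnits.JohnsonLeungKings2011

end
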